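import Literature.MathematicalPhysics.QuantumFieldTheory.Balaban1983to89.B9Eq325QprimeStarLowerBoundZd
import Literature.MathematicalPhysics.QuantumFieldTheory.Balaban1983to89.B9Eq324DeltaPrimeUpperBoundZd

/-!
# `Balaban1983to89.B9Eq324NearFlatFormComparisonZd` — [Balaban1985BackgroundPropagators] (3.23)–(3.24) p. 394, Thm 3.1 p. 397 ∕ Thm 3.11 p. 416 with (3.82)–(3.86) p. 407
# («doing the gauge transformation we get the configuration U = e^{iηA} with A small … G_□(e^{iηA}) = G_□(1)(I − V(A)G_□(1))⁻¹») AT THE `ℤᵈ × 𝔸` CARRIER: THE FORM OF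
# `Ω₀Δ′_a(U₀)Ω₀` AT A NEAR-FLAT BACKGROUND DOMINATES HALF THE FLAT FORM UP TO AN EXPLICIT, SCALE-FREE ERROR —
# `⟨f, Ω₀Δ′_a(1)Ω₀ f⟩_τ ≤ 2⟨f, Ω₀Δ′_a(U₀)Ω₀ f⟩_τ + 2(dθ² + κ)⟨f, f⟩_τ` whenever the bond conjugations are `θη`-close to the identity in the `τ`-size
# (`|R(U₀(b))a − a|_τ ≤ θη|a|_τ` — print's `U = e^{iηA}`, `|A| ≤ θ`) and the averaged transporters of level `i` are `ε_i`-close with `a_j(Lᵈ)^{−j}(Σ_{i<j}ε_i)² ≤ κ`; hence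
# every FLAT coercivity constant `a₀` (this seat's `B9Thm31FlatPoincareCoerciveZd`: `a₀ = min{8, a}`) transfers as `a₀∕2 − dθ² − κ` to the near-flat background — member-uniform

statement-level skeleton of published theorems with citation tags; proofs where landed; nothing here is a claim about the
Yang–Mills mass gap

`[Balaban1985BackgroundPropagators]` ("B9", CMP **99** (1985) 389–434) (3.23)–(3.24) p. 394 (`Δ′_a = D*_UD_U + Σ_j a_jQ′_j(U)*Q′_j(U)` at the background, `Ω₀Δ′_aΩ₀`),
(3.18)–(3.19) p. 393 (`Q′_j`), Thm 3.1 p. 397 and Thm 3.11 p. 416 («Δ′_a, G′ … positive definite»), p. 416 («we get the configuration U = e^{iηA} with A small, and by (3.86)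
… In [4] we have proved that the operator G_□(1) is positive, hence by the same reasoning as above we prove positivity»); `[Balaban1985Averaging]` (122)–(126) p. 36 (the averaged
transporters near `1`); `[Balaban1985RegularSpaces]` (1.1) p. 76 (`D^η_U`).  The comparison is the two-term inequality `|a|² ≤ 2|b|² + 2|a − b|²` applied to `D^η_1f = D^η_{U₀}f −
η⁻¹(R(U₀)−1)f(·+e_μ)` and to `Q′_j(1)f = Q′_j(U₀)f − (transport defects)`, the latter summed over the disjoint blocks with Cauchy–Schwarz.  PDF held:
`paper:balaban1985-cmp99-background-propagators` pp. 393–394, 416 (re-read 2026-08-28).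

CITATION HEADER (lean-in-tree rule).  Cell `pub-ymgap` (YM Track A, D-0062 ∕ D-0149), node N06 = [B9], width seat `pub-ymgap-dag-n06-w4` (g5), CLAIM-6 ∕ INTENT-6 — the CURVED half of the
member-uniform coercivity programme (flat half: `B9Thm31FlatPoincareCoerciveZd`, CLAIM-5).  Inputs BY NAME: g5 `B9Eq325QprimeStarLowerBoundZd` (`fnorm_trIter`, `single_mem_suppSub`),
g2 `B9Eq325QprimeSingleSiteZd` (`trIter`, `QprimeIter_single`, `blockMapIter_eq_blockMap_pow`), g2 `B9Eq324DeltaPrimeAZd` (`formE_deltaPrimeADom`, `eq_sum_single`, `QprimeLin`), g4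
`B9Eq324DeltaPrimeUpperBoundZd.sum_fnorm_sq_le_formE`, dag-n06-w2's `B9Eq342CombesThomasFormZd` (`fnorm…`) and `B9Thm31GpDecayOfCoerciveZd` (`fnorm_conjR_of_unitary`, `fnorm_sub_le`),
dag-n05's `B8Eq191FlatStencils.covDerivFwd_flat_apply`, `QuantumLattice.BalabanRG` (`blockSites`, `card_blockSites`).  Nearest tree statements: dag-n05-w3's `B8Ineq159StencilsNearFlat` /
`B8Ineq159TowerNearFlat` (the same near-flat stencil comparisons in OPERATOR norm `‖·‖` for the (1.59) data) — here in the `τ`-size for the N06 form, not restated.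

WHAT IS PROVED (kernel, 0 sorry; theorems only — no `def`, `instance`, `notation`; faithful Hermitian tracial `τ` a PARAMETER; `η > 0`).
* §1 `fnorm_sq_le_two_mul_add`, ★ `fnorm_trIter_sub_flat_le` (`|trIter_j(U₀) x a − (Lᵈ)^{−j}a|_τ ≤ (Lᵈ)^{−j}(Σ_{i<j}ε_i)|a|_τ`: unitary transporters `ε_i`-close to `1` in the `τ`-size).
* §2 ★ `QprimeIter_eq_blockSum_trIter` (`(Q′_j(U₀)f)(y) = Σ_{Bʲ(y)} trIter_j(U₀) x (f x)`, every background of units, `f ∈ L²(Ω₀, ·)`), ★★ `fnorm_QprimeIter_sub_one_sq_le`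
  (`|(Q′_j(U₀)f)(y) − (Q′_j(1)f)(y)|²_τ ≤ (Lᵈ)^{−j}(Σ_{i<j}ε_i)²·Σ_{Bʲ(y)}|f|²_τ`).
* §3 ★ `fnorm_covDerivFwd_one_sq_le` (`|D^η_1f(x)|²_τ ≤ 2|D^η_{U₀}f(x)|²_τ + 2θ²|f(x+e_μ)|²_τ` under `|R(U₀(x,μ))a − a|_τ ≤ θη|a|_τ`), ★★ `gradEnergy_one_le` (summed: `≤ 2·(gradient energy
  at U₀) + 2dθ²⟨f, f⟩_τ`).
* §4 ★★ `penalty_one_le` (`Σ_j a_jΣ_y|Q′_j(1)f|²_τ ≤ 2Σ_j a_jΣ_y|Q′_j(U₀)f|²_τ + 2κ⟨f, f⟩_τ` for pairwise disjoint blocks and `a_j(Lᵈ)^{−j}(Σ_{i<j}ε_i)² ≤ κ`).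
* §5 ★★★ `formE_deltaPrimeADom_one_le_near_flat` (`⟨f, Ω₀Δ′_a(1)Ω₀f⟩_τ ≤ 2⟨f, Ω₀Δ′_a(U₀)Ω₀f⟩_τ + 2(dθ² + κ)⟨f, f⟩_τ`), ★★★ `coercive_of_flat_coercive_near_flat` (a flat constant `a₀`
  gives `(a₀∕2 − dθ² − κ)·⟨f, f⟩_τ ≤ ⟨f, Ω₀Δ′_a(U₀)Ω₀f⟩_τ` at the near-flat background).

HONEST SCOPE.  (i) The closeness hypotheses are DISPLAYED in the `τ`-size at scale `η` (print's `U = e^{iηA}`, `A` small AFTER the block gauge fixing of Sect. B); deriving them on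
the class (3.35) from the plaquette bounds needs the axial gauge + [Balaban1985Averaging] (122)–(126) and the gauge covariance of the form — NOT here.  (ii) Constants explicit and
scale-free (`2`, `dθ²`, `κ`); `L²_τ` currency, no decay.  Count-neutral helper (`--supports` the K1 item of record); N05 ∕ N06 NOT discharged; K1 NOT closed; one finite `𝕋⁴`
programme at fixed `ε`, Bałaban as printed; R4 closes only the conditional finite-`𝕋⁴` rung `BalabanLadder.UV` — nothing continuum ∕ ℝ⁴ ∕ OS ∕ mass gap ∕ Clay.
Unit `pub-ymgap-dag-n06-w4` (g5), 2026-08-28.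
-/

noncomputable section

namespace Literature.MathematicalPhysics.QuantumFieldTheory.Balaban1983to89.B9Eq324NearFlatFormComparisonZd

open B7Prop1Explicit
open B7Eq78Linearization (conjR conjR_apply conjR_sub conjR_smul_real QprimeIter zdBlocking)
open B7Prop2Explicit (unitaryUnits)
open B8Ineq132 (covDerivFwd)
open B8Eq119TwistedAxial (bgT bgT_one)
open Literature.MathematicalPhysics.QuantumLattice (blockMap blockSites mem_blockSites_iff card_blockSites)
open B9Eq321LandauProjectionZd (suppSub formE formE_apply)
open B9Eq324DeltaPrimeAZd (single eq_sum_single QprimeLin QprimeLin_apply deltaPrimeADom formE_deltaPrimeADom)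
open B9Eq325QprimeSingleSiteZd (blockMapIter blockMapIter_eq_blockMap_pow trIter trIter_zero trIter_succ QprimeIter_single)
open B9Eq342CombesThomasFormZd (fnorm fnorm_nonneg fnorm_sq fnorm_smul fnorm_zero fnorm_add_le fnorm_sum_le formE_self_eq_sum_sq formE_self_nonneg')
open B9Thm31GpDecayOfCoerciveZd (fnorm_conjR_of_unitary fnorm_sub_le fnorm_neg')
open B9Eq324DeltaPrimeUpperBoundZd (sum_fnorm_sq_le_formE)
open B9Eq325QprimeStarLowerBoundZd (fnorm_trIter)
open B8Eq191FlatStencils (conjR_unitOne covDerivFwd_flat_apply)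

-- `Site` alone could resolve to the torus sites of `Setup.lean`; re-export the `ℤ^d` sites of `B7Prop1Explicit`.
export B7Prop1Explicit (Site)

variable {d : ℕ} {𝔸 : Type*} [CStarAlgebra 𝔸]
variable (τ : 𝔸 →ₗ[ℂ] ℂ) (hτp : ∀ a : 𝔸, a ≠ 0 → 0 < (τ (star a * a)).re)
  (hτt : ∀ a b : 𝔸, τ (a * b) = τ (b * a)) (hτs : ∀ a : 𝔸, τ (star a) = starRingEnd ℂ (τ a))

/-! ## §1  Fibre bookkeeping and the transport defect -/

section Fibre

include hτp hτs in
/-- `|a|²_τ ≤ 2|b|²_τ + 2|a − b|²_τ`. [cite: Balaban1985BackgroundPropagators, p.390 («|X|² = tr X*X»; bookkeeping)] -/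
theorem fnorm_sq_le_two_mul_add (a b : 𝔸) : fnorm τ a ^ 2 ≤ 2 * fnorm τ b ^ 2 + 2 * fnorm τ (a - b) ^ 2 := by
  have h : fnorm τ a ≤ fnorm τ b + fnorm τ (a - b) := by
    have := fnorm_add_le hτp hτs b (a - b)
    rwa [add_sub_cancel] at this
  have h0 := fnorm_nonneg τ a
  have h1 := fnorm_nonneg τ b
  have h2 := fnorm_nonneg τ (a - b)
  nlinarith [h, sq_nonneg (fnorm τ b - fnorm τ (a - b))]

variable {L : ℕ} {U₀ : Site d → Fin d → 𝔸ˣ}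

include hτp hτt hτs in
/-- ★ **THE TRANSPORT DEFECT**: if the averaged transporters `Ū₀ⁱ(Γ)`, `i < j`, are unitary and `ε_i`-close to `1` in the `τ`-size (`|R(T)a − a|_τ ≤ ε_i|a|_τ`), then
`|trIter_j(U₀) x a − (Lᵈ)^{−j}a|_τ ≤ (Lᵈ)^{−j}·(Σ_{i<j} ε_i)·|a|_τ` (induction on (3.19): each step adds one defect and preserves the earlier ones isometrically).
[cite: Balaban1985BackgroundPropagators, (3.18)–(3.19) p.393; Balaban1985Averaging, (122)–(126) p.36] -/
theorem fnorm_trIter_sub_flat_le {ε : ℕ → ℝ} (x : Site d) (a : 𝔸) :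
    ∀ j : ℕ, (∀ i, i < j → ∀ z y : Site d, bgT L U₀ i z y ∈ unitaryUnits 𝔸) →
      (∀ i, i < j → ∀ (z y : Site d) (b : 𝔸), fnorm τ (conjR (bgT L U₀ i z y) b - b) ≤ ε i * fnorm τ b) →
        fnorm τ (trIter L U₀ j x a - (((L : ℝ) ^ d)⁻¹) ^ j • a) ≤
          (((L : ℝ) ^ d)⁻¹) ^ j * (∑ i ∈ Finset.range j, ε i) * fnorm τ a := by
  intro j
  induction j with
  | zero =>
    intro _ _
    rw [trIter_zero, pow_zero, one_smul, sub_self, fnorm_zero, Finset.range_zero, Finset.sum_empty, mul_zero, zero_mul]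
  | succ j ih =>
    intro hT hTε
    have hc0 : (0 : ℝ) ≤ ((L : ℝ) ^ d)⁻¹ := by positivity
    set c : ℝ := ((L : ℝ) ^ d)⁻¹ with hc
    set T := bgT L U₀ j (blockMapIter L (j + 1) x) (blockMapIter L j x) with hTdef
    have ih' := ih (fun i hi => hT i (Nat.lt_succ_of_lt hi)) (fun i hi => hTε i (Nat.lt_succ_of_lt hi))
    -- split the step: `c • R(T)(trIter_j a) − c^{j+1} a = c • R(T)(trIter_j a − c^j a) + c^{j+1}(R(T)a − a)`
    have hsplit : trIter L U₀ (j + 1) x a - c ^ (j + 1) • a =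
        c • conjR T (trIter L U₀ j x a - c ^ j • a) + c ^ (j + 1) • (conjR T a - a) := by
      rw [trIter_succ, ← hTdef, ← hc, conjR_sub, conjR_smul_real, smul_sub, smul_sub, smul_smul, ← pow_succ']
      abel
    rw [hsplit]
    calc fnorm τ (c • conjR T (trIter L U₀ j x a - c ^ j • a) + c ^ (j + 1) • (conjR T a - a))
        ≤ fnorm τ (c • conjR T (trIter L U₀ j x a - c ^ j • a)) + fnorm τ (c ^ (j + 1) • (conjR T a - a)) := fnorm_add_le hτp hτs _ _
      _ = c * fnorm τ (trIter L U₀ j x a - c ^ j • a) + c ^ (j + 1) * fnorm τ (conjR T a - a) := by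
          rw [fnorm_smul, fnorm_smul, fnorm_conjR_of_unitary τ hτt (hT j (Nat.lt_succ_self j) _ _), abs_of_nonneg hc0,
            abs_of_nonneg (pow_nonneg hc0 _)]
      _ ≤ c * (c ^ j * (∑ i ∈ Finset.range j, ε i) * fnorm τ a) + c ^ (j + 1) * (ε j * fnorm τ a) :=
          add_le_add (mul_le_mul_of_nonneg_left ih' hc0) (mul_le_mul_of_nonneg_left (hTε j (Nat.lt_succ_self j) _ _ a) (pow_nonneg hc0 _))
      _ = c ^ (j + 1) * (∑ i ∈ Finset.range (j + 1), ε i) * fnorm τ a := by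
          rw [Finset.sum_range_succ, pow_succ]
          ring

end Fibre

/-! ## §2  `Q′_j(U₀)` on `L²(Ω₀, ·)` as a block sum of fibre transports; the averaging defect -/

section Averaging

variable {L : ℕ} [NeZero L] (U₀ : Site d → Fin d → 𝔸ˣ) {s : Finset (Site d)}

/-- ★ **`(Q′_j(U₀)f)(y) = Σ_{x∈Bʲ(y)} trIter_j(U₀) x (f x)`** for `f ∈ L²(Ω₀, ·)` and EVERY background of units (the sites of the block off `Ω₀` carry `f = 0`).
[cite: Balaban1985BackgroundPropagators, (3.18)–(3.19) p.393] -/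
theorem QprimeIter_eq_blockSum_trIter (f : suppSub (𝔸 := 𝔸) s) (j : ℕ) (y : Site d) :
    QprimeIter (zdBlocking d L) (bgT L U₀) j (f : Site d → 𝔸) y = ∑ x ∈ blockSites (L ^ j) y, trIter L U₀ j x ((f : Site d → 𝔸) x) := by
  classical
  haveI : NeZero (L ^ j) := ⟨pow_ne_zero j (NeZero.ne L)⟩
  have hmem : ∀ x : Site d, x ∈ blockSites (L ^ j) y ↔ blockMapIter L j x = y := fun x => by
    rw [mem_blockSites_iff, blockMapIter_eq_blockMap_pow]
  have hf : (f : Site d → 𝔸) = ∑ x ∈ s, single x ((f : Site d → 𝔸) x) :=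
    eq_sum_single fun k hk => by by_contra hks; exact hk (f.2 k hks)
  have h1 : QprimeIter (zdBlocking d L) (bgT L U₀) j (f : Site d → 𝔸) y =
      ∑ x ∈ s, QprimeIter (zdBlocking d L) (bgT L U₀) j (single x ((f : Site d → 𝔸) x)) y := by
    have h := congr_fun (map_sum (QprimeLin L U₀ j) (fun x => single x ((f : Site d → 𝔸) x)) s) y
    simp only [QprimeLin_apply, Finset.sum_apply] at h
    rw [← hf] at h
    exact h
  rw [h1, Finset.sum_congr rfl fun x _ => QprimeIter_single L U₀ x ((f : Site d → 𝔸) x) j y, ← Finset.sum_filter]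
  refine Finset.sum_subset (fun x hx => ?_) (fun x hxB hx => ?_)
  · rw [Finset.mem_filter] at hx
    exact (hmem x).2 hx.2
  · have hxs : x ∉ s := by
      intro h'
      exact hx (Finset.mem_filter.2 ⟨h', (hmem x).1 hxB⟩)
    rw [f.2 x hxs]
    -- `trIter_j x 0 = 0`
    have h0 : ∀ i : ℕ, trIter L U₀ i x (0 : 𝔸) = 0 := by
      intro i
      induction i with
      | zero => rfl
      | succ i ih => rw [trIter_succ, ih, conjR_apply, mul_zero, zero_mul, smul_zero]
    exact h0 j

include hτp hτt hτs in
/-- ★★ **THE AVERAGING DEFECT ON A BLOCK**: with unitary, `ε_i`-close averaged transporters below level `j`,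
`|(Q′_j(U₀)f)(y) − (Q′_j(1)f)(y)|²_τ ≤ (Lᵈ)^{−j}·(Σ_{i<j}ε_i)²·Σ_{x∈Bʲ(y)} |f x|²_τ` (the pointwise defect of §1 summed over the `(Lʲ)^d` sites, Cauchy–Schwarz).
[cite: Balaban1985BackgroundPropagators, (3.18)–(3.19) p.393, (3.24) p.394; Balaban1985Averaging, (122)–(126) p.36] -/
theorem fnorm_QprimeIter_sub_one_sq_le {ε : ℕ → ℝ} (hε : ∀ i, 0 ≤ ε i) (f : suppSub (𝔸 := 𝔸) s) {j : ℕ}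
    (hT : ∀ i, i < j → ∀ z y : Site d, bgT L U₀ i z y ∈ unitaryUnits 𝔸)
    (hTε : ∀ i, i < j → ∀ (z y : Site d) (b : 𝔸), fnorm τ (conjR (bgT L U₀ i z y) b - b) ≤ ε i * fnorm τ b) (y : Site d) :
    fnorm τ (QprimeIter (zdBlocking d L) (bgT L U₀) j (f : Site d → 𝔸) y -
        QprimeIter (zdBlocking d L) (bgT L (1 : Site d → Fin d → 𝔸ˣ)) j (f : Site d → 𝔸) y) ^ 2 ≤
      (((L : ℝ) ^ d) ^ j)⁻¹ * (∑ i ∈ Finset.range j, ε i) ^ 2 * ∑ x ∈ blockSites (L ^ j) y, fnorm τ ((f : Site d → 𝔸) x) ^ 2 := by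
  classical
  set B := blockSites (L ^ j) y with hB
  set c : ℝ := ((L : ℝ) ^ d)⁻¹ with hc
  set E : ℝ := ∑ i ∈ Finset.range j, ε i with hE
  have hc0 : 0 ≤ c := by positivity
  have hE0 : 0 ≤ E := Finset.sum_nonneg fun i _ => hε i
  have hL0 : (0 : ℝ) < (L : ℝ) := by exact_mod_cast Nat.pos_of_ne_zero (NeZero.ne L)
  -- the flat transport is the scalar `c^j`
  have hflat : ∀ x : Site d, trIter L (1 : Site d → Fin d → 𝔸ˣ) j x ((f : Site d → 𝔸) x) = c ^ j • (f : Site d → 𝔸) x := by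
    intro x
    have h : ∀ i : ℕ, trIter L (1 : Site d → Fin d → 𝔸ˣ) i x ((f : Site d → 𝔸) x) = c ^ i • (f : Site d → 𝔸) x := by
      intro i
      induction i with
      | zero => rw [trIter_zero, pow_zero, one_smul]
      | succ i ih => rw [trIter_succ, ih, bgT_one, conjR_unitOne, smul_smul, hc, pow_succ, mul_comm]
    exact h j
  -- the difference as a block sum of pointwise defects
  have hdiff : QprimeIter (zdBlocking d L) (bgT L U₀) j (f : Site d → 𝔸) y -
      QprimeIter (zdBlocking d L) (bgT L (1 : Site d → Fin d → 𝔸ˣ)) j (f : Site d → 𝔸) y =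
        ∑ x ∈ B, (trIter L U₀ j x ((f : Site d → 𝔸) x) - c ^ j • (f : Site d → 𝔸) x) := by
    rw [QprimeIter_eq_blockSum_trIter U₀ f j y, QprimeIter_eq_blockSum_trIter (1 : Site d → Fin d → 𝔸ˣ) f j y, ← hB, ← Finset.sum_sub_distrib]
    exact Finset.sum_congr rfl fun x _ => by rw [hflat x]
  -- pointwise defect, then the triangle inequality over the block
  have hpt : ∀ x ∈ B, fnorm τ (trIter L U₀ j x ((f : Site d → 𝔸) x) - c ^ j • (f : Site d → 𝔸) x) ≤ c ^ j * E * fnorm τ ((f : Site d → 𝔸) x) :=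
    fun x _ => fnorm_trIter_sub_flat_le τ hτp hτt hτs x _ j hT hTε
  have h1 : fnorm τ (QprimeIter (zdBlocking d L) (bgT L U₀) j (f : Site d → 𝔸) y -
      QprimeIter (zdBlocking d L) (bgT L (1 : Site d → Fin d → 𝔸ˣ)) j (f : Site d → 𝔸) y) ≤ c ^ j * E * ∑ x ∈ B, fnorm τ ((f : Site d → 𝔸) x) := by
    rw [hdiff]
    refine (fnorm_sum_le hτp hτs _ _).trans ?_
    rw [Finset.mul_sum]
    exact Finset.sum_le_sum hpt
  have h0 : 0 ≤ fnorm τ (QprimeIter (zdBlocking d L) (bgT L U₀) j (f : Site d → 𝔸) y -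
      QprimeIter (zdBlocking d L) (bgT L (1 : Site d → Fin d → 𝔸ˣ)) j (f : Site d → 𝔸) y) := fnorm_nonneg τ _
  -- Cauchy–Schwarz: `(Σ_B |f|)² ≤ |B|·Σ_B |f|²`, `|B| = (Lᵈ)ʲ`, `c^j (Lᵈ)^j = 1`
  have hCS := sq_sum_le_card_mul_sum_sq (s := B) (f := fun x => fnorm τ ((f : Site d → 𝔸) x))
  rw [hB, card_blockSites] at hCS
  push_cast at hCS
  have hcard : (((L : ℝ) ^ j) ^ d) = ((L : ℝ) ^ d) ^ j := by rw [← pow_mul, ← pow_mul, mul_comm]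
  rw [hcard] at hCS
  have hcj : c ^ j * ((L : ℝ) ^ d) ^ j = 1 := by
    rw [hc, inv_pow, inv_mul_cancel₀ (by positivity)]
  calc fnorm τ _ ^ 2 ≤ (c ^ j * E * ∑ x ∈ B, fnorm τ ((f : Site d → 𝔸) x)) ^ 2 := pow_le_pow_left₀ h0 h1 2
    _ = (c ^ j) ^ 2 * E ^ 2 * (∑ x ∈ B, fnorm τ ((f : Site d → 𝔸) x)) ^ 2 := by ring
    _ ≤ (c ^ j) ^ 2 * E ^ 2 * (((L : ℝ) ^ d) ^ j * ∑ x ∈ B, fnorm τ ((f : Site d → 𝔸) x) ^ 2) :=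
        mul_le_mul_of_nonneg_left (by rw [hB]; exact hCS) (by positivity)
    _ = (((L : ℝ) ^ d) ^ j)⁻¹ * E ^ 2 * ∑ x ∈ B, fnorm τ ((f : Site d → 𝔸) x) ^ 2 := by
        have : (c ^ j) ^ 2 * ((L : ℝ) ^ d) ^ j = (((L : ℝ) ^ d) ^ j)⁻¹ := by
          rw [sq, mul_assoc, hcj, mul_one, hc, inv_pow]
        rw [← this, hB]
        ring

end Averaging

/-! ## §3  The gradient energy at the flat background against the one at `U₀` -/

section Gradient

variable {η : ℝ} {U₀ : Site d → Fin d → 𝔸ˣ} {θ : ℝ}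

include hτp hτs in
/-- ★ **POINTWISE**: if `|R(U₀(x,μ))a − a|_τ ≤ θη·|a|_τ` for all `a`, then `|D^η_{1,μ}f(x)|²_τ ≤ 2|D^η_{U₀,μ}f(x)|²_τ + 2θ²|f(x+e_μ)|²_τ`
(`D^η_1f(x) = D^η_{U₀}f(x) − η⁻¹(R(U₀(x,μ)) − 1)f(x+e_μ)`). [cite: Balaban1985RegularSpaces, (1.1) p.76; Balaban1985BackgroundPropagators, (3.23) p.394, p.416 («U = e^{iηA} with A small»)] -/
theorem fnorm_covDerivFwd_one_sq_le (hη : 0 < η)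
    (hR : ∀ (x : Site d) (μ : Fin d) (a : 𝔸), fnorm τ (conjR (U₀ x μ) a - a) ≤ θ * η * fnorm τ a)
    (F : Site d → 𝔸) (μ : Fin d) (x : Site d) :
    fnorm τ (covDerivFwd η (1 : Site d → Fin d → 𝔸ˣ) μ F x) ^ 2 ≤
      2 * fnorm τ (covDerivFwd η U₀ μ F x) ^ 2 + 2 * θ ^ 2 * fnorm τ (F (x + e μ)) ^ 2 := by
  have hdiff : covDerivFwd η (1 : Site d → Fin d → 𝔸ˣ) μ F x - covDerivFwd η U₀ μ F x = η⁻¹ • (F (x + e μ) - conjR (U₀ x μ) (F (x + e μ))) := by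
    rw [covDerivFwd_flat_apply, covDerivFwd, ← smul_sub]
    congr 1
    abel
  have h1 := fnorm_sq_le_two_mul_add τ hτp hτs (covDerivFwd η (1 : Site d → Fin d → 𝔸ˣ) μ F x) (covDerivFwd η U₀ μ F x)
  have h2 : fnorm τ (covDerivFwd η (1 : Site d → Fin d → 𝔸ˣ) μ F x - covDerivFwd η U₀ μ F x) ≤ θ * fnorm τ (F (x + e μ)) := by
    rw [hdiff, fnorm_smul, abs_of_pos (inv_pos.2 hη), ← neg_sub, fnorm_neg']
    calc η⁻¹ * fnorm τ (conjR (U₀ x μ) (F (x + e μ)) - F (x + e μ)) ≤ η⁻¹ * (θ * η * fnorm τ (F (x + e μ))) :=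
          mul_le_mul_of_nonneg_left (hR x μ _) (inv_pos.2 hη).le
      _ = θ * fnorm τ (F (x + e μ)) := by field_simp
  have h3 : fnorm τ (covDerivFwd η (1 : Site d → Fin d → 𝔸ˣ) μ F x - covDerivFwd η U₀ μ F x) ^ 2 ≤ θ ^ 2 * fnorm τ (F (x + e μ)) ^ 2 := by
    have := pow_le_pow_left₀ (fnorm_nonneg τ _) h2 2
    rwa [mul_pow] at this
  linarith

include hτp hτs in
/-- ★★ **THE GRADIENT ENERGY AT `1` AGAINST THE ONE AT `U₀`**: `Σ_μ Σᶠ_x |D^η_1f(x)|²_τ ≤ 2Σ_μ Σᶠ_x |D^η_{U₀}f(x)|²_τ + 2dθ²·⟨f, f⟩_τ` for `f ∈ L²(Ω₀, ·)`.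
[cite: Balaban1985BackgroundPropagators, (3.23)–(3.24) p.394, p.416; Balaban1985RegularSpaces, (1.1) p.76] -/
theorem gradEnergy_one_le (hη : 0 < η)
    (hR : ∀ (x : Site d) (μ : Fin d) (a : 𝔸), fnorm τ (conjR (U₀ x μ) a - a) ≤ θ * η * fnorm τ a)
    {s : Finset (Site d)} (f : suppSub (𝔸 := 𝔸) s) :
    ∑ μ : Fin d, ∑ᶠ x, fnorm τ (covDerivFwd η (1 : Site d → Fin d → 𝔸ˣ) μ (f : Site d → 𝔸) x) ^ 2 ≤
      2 * ∑ μ : Fin d, ∑ᶠ x, fnorm τ (covDerivFwd η U₀ μ (f : Site d → 𝔸) x) ^ 2 + 2 * d * θ ^ 2 * formE τ s f f := by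
  classical
  set F : Site d → 𝔸 := (f : Site d → 𝔸) with hF
  -- per direction, everything lives on `T = s ∪ (s − e_μ)`
  have hdir : ∀ μ : Fin d, ∑ᶠ x, fnorm τ (covDerivFwd η (1 : Site d → Fin d → 𝔸ˣ) μ F x) ^ 2 ≤
      2 * ∑ᶠ x, fnorm τ (covDerivFwd η U₀ μ F x) ^ 2 + 2 * θ ^ 2 * formE τ s f f := by
    intro μ
    set T : Finset (Site d) := s ∪ s.image (fun z => z - e μ) with hT
    -- off `T` both `F x` and `F (x + e_μ)` vanish
    have hoff : ∀ x, x ∉ T → F x = 0 ∧ F (x + e μ) = 0 := by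
      intro x hxT
      rw [hT, Finset.mem_union, Finset.mem_image, not_or, not_exists] at hxT
      refine ⟨f.2 x hxT.1, ?_⟩
      by_contra hne
      have hmem : x + e μ ∈ s := by by_contra hh; exact hne (f.2 _ hh)
      exact hxT.2 (x + e μ) ⟨hmem, by simp⟩
    have hsupp : ∀ V : Site d → Fin d → 𝔸ˣ, (Function.support fun x => fnorm τ (covDerivFwd η V μ F x) ^ 2) ⊆ ↑T := by
      intro V x hx
      rw [Function.mem_support] at hx
      by_contra hxT
      apply hx
      obtain ⟨h1, h2⟩ := hoff x hxT
      rw [covDerivFwd, h1, h2, conjR_apply, mul_zero, zero_mul, sub_zero, smul_zero, fnorm_zero]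
      ring
    rw [finsum_eq_sum_of_support_subset _ (hsupp 1), finsum_eq_sum_of_support_subset _ (hsupp U₀)]
    have hpt := fun x => fnorm_covDerivFwd_one_sq_le τ hτp hτs hη hR F μ x
    have hshift : ∑ x ∈ T, fnorm τ (F (x + e μ)) ^ 2 ≤ formE τ s f f := by
      rw [← Finset.sum_image (f := fun y => fnorm τ (F y) ^ 2) (s := T) (g := fun x => x + e μ) fun x _ y _ h => add_right_cancel h]
      exact sum_fnorm_sq_le_formE τ hτp f _
    calc ∑ x ∈ T, fnorm τ (covDerivFwd η (1 : Site d → Fin d → 𝔸ˣ) μ F x) ^ 2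
        ≤ ∑ x ∈ T, (2 * fnorm τ (covDerivFwd η U₀ μ F x) ^ 2 + 2 * θ ^ 2 * fnorm τ (F (x + e μ)) ^ 2) := Finset.sum_le_sum fun x _ => hpt x
      _ = 2 * ∑ x ∈ T, fnorm τ (covDerivFwd η U₀ μ F x) ^ 2 + 2 * θ ^ 2 * ∑ x ∈ T, fnorm τ (F (x + e μ)) ^ 2 := by
          rw [Finset.sum_add_distrib, Finset.mul_sum, Finset.mul_sum]
      _ ≤ 2 * ∑ x ∈ T, fnorm τ (covDerivFwd η U₀ μ F x) ^ 2 + 2 * θ ^ 2 * formE τ s f f := by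
          have h2θ : 0 ≤ 2 * θ ^ 2 := by positivity
          linarith [mul_le_mul_of_nonneg_left hshift h2θ]
  calc ∑ μ : Fin d, ∑ᶠ x, fnorm τ (covDerivFwd η (1 : Site d → Fin d → 𝔸ˣ) μ F x) ^ 2
      ≤ ∑ μ : Fin d, (2 * ∑ᶠ x, fnorm τ (covDerivFwd η U₀ μ F x) ^ 2 + 2 * θ ^ 2 * formE τ s f f) := Finset.sum_le_sum fun μ _ => hdir μ
    _ = 2 * ∑ μ : Fin d, ∑ᶠ x, fnorm τ (covDerivFwd η U₀ μ F x) ^ 2 + 2 * d * θ ^ 2 * formE τ s f f := by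
        rw [Finset.sum_add_distrib, Finset.mul_sum, Finset.sum_const, Finset.card_univ, Fintype.card_fin, nsmul_eq_mul]
        ring

end Gradient

/-! ## §4  The averaging penalty at the flat background against the one at `U₀` -/

section Penalty

variable {L : ℕ} [NeZero L] {U₀ : Site d → Fin d → 𝔸ˣ}

include hτp hτt hτs in
/-- ★★ **THE PENALTY AT `1` AGAINST THE ONE AT `U₀`**: for pairwise disjoint level blocks of the constraint points (print's «Ω_j ∖ Ω_{j+1} = Bʲ(Λ_j)»), non-negative weights with
`a_j·(Lᵈ)^{−j}·(Σ_{i<j}ε_i)² ≤ κ` (`j ≤ m`), and unitary averaged transporters below `m` that are `ε_i`-close to `1` in the `τ`-size: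
`Σ_{j≤m} a_j Σ_{y∈Λ_j} |(Q′_j(1)f)(y)|²_τ ≤ 2·Σ_{j≤m} a_j Σ_{y∈Λ_j} |(Q′_j(U₀)f)(y)|²_τ + 2κ·⟨f, f⟩_τ`.
[cite: Balaban1985BackgroundPropagators, (3.18)–(3.19) p.393, (3.23)–(3.24) p.394; Balaban1985Averaging, (122)–(126) p.36] -/
theorem penalty_one_le (m : ℕ) {a : ℕ → ℝ} (ha : ∀ j, 0 ≤ a j) (Λ : ℕ → Finset (Site d)) {s : Finset (Site d)}
    (hdisj : ∀ j ∈ Finset.range (m + 1), ∀ y ∈ Λ j, ∀ i ∈ Finset.range (m + 1), ∀ y' ∈ Λ i, (i, y') ≠ (j, y) →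
      ∀ x : Site d, blockMapIter L j x = y → blockMapIter L i x ≠ y')
    {ε : ℕ → ℝ} (hε : ∀ i, 0 ≤ ε i) (hT : ∀ i, i < m → ∀ z y : Site d, bgT L U₀ i z y ∈ unitaryUnits 𝔸)
    (hTε : ∀ i, i < m → ∀ (z y : Site d) (b : 𝔸), fnorm τ (conjR (bgT L U₀ i z y) b - b) ≤ ε i * fnorm τ b)
    {κ : ℝ} (hκ0 : 0 ≤ κ) (hκ : ∀ j ∈ Finset.range (m + 1), a j * ((((L : ℝ) ^ d) ^ j)⁻¹ * (∑ i ∈ Finset.range j, ε i) ^ 2) ≤ κ)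
    (f : suppSub (𝔸 := 𝔸) s) :
    ∑ j ∈ Finset.range (m + 1), a j * ∑ y ∈ Λ j,
        fnorm τ (QprimeIter (zdBlocking d L) (bgT L (1 : Site d → Fin d → 𝔸ˣ)) j (f : Site d → 𝔸) y) ^ 2 ≤
      2 * ∑ j ∈ Finset.range (m + 1), a j * ∑ y ∈ Λ j, fnorm τ (QprimeIter (zdBlocking d L) (bgT L U₀) j (f : Site d → 𝔸) y) ^ 2 +
        2 * κ * formE τ s f f := by
  classical
  set F : Site d → 𝔸 := (f : Site d → 𝔸) with hF
  let blk : ℕ × Site d → Finset (Site d) := fun p => blockSites (L ^ p.1) p.2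
  -- pointwise in `(j, y)`: two-term inequality + the block defect
  have hpt : ∀ j ∈ Finset.range (m + 1), ∀ y ∈ Λ j,
      a j * fnorm τ (QprimeIter (zdBlocking d L) (bgT L (1 : Site d → Fin d → 𝔸ˣ)) j F y) ^ 2 ≤
        2 * (a j * fnorm τ (QprimeIter (zdBlocking d L) (bgT L U₀) j F y) ^ 2) + 2 * κ * ∑ x ∈ blk (j, y), fnorm τ (F x) ^ 2 := by
    intro j hj y _
    have hjm : j ≤ m := Nat.lt_succ_iff.1 (Finset.mem_range.1 hj)
    have h1 := fnorm_sq_le_two_mul_add τ hτp hτs (QprimeIter (zdBlocking d L) (bgT L (1 : Site d → Fin d → 𝔸ˣ)) j F y)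
      (QprimeIter (zdBlocking d L) (bgT L U₀) j F y)
    have h2 := fnorm_QprimeIter_sub_one_sq_le τ hτp hτt hτs U₀ hε f (j := j) (fun i hi => hT i (lt_of_lt_of_le hi hjm))
      (fun i hi => hTε i (lt_of_lt_of_le hi hjm)) y
    rw [← neg_sub, fnorm_neg'] at h1
    have hS : 0 ≤ ∑ x ∈ blk (j, y), fnorm τ (F x) ^ 2 := Finset.sum_nonneg fun _ _ => sq_nonneg _
    have h3 : a j * fnorm τ (QprimeIter (zdBlocking d L) (bgT L U₀) j F y -
        QprimeIter (zdBlocking d L) (bgT L (1 : Site d → Fin d → 𝔸ˣ)) j F y) ^ 2 ≤ κ * ∑ x ∈ blk (j, y), fnorm τ (F x) ^ 2 := by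
      calc a j * fnorm τ _ ^ 2 ≤ a j * ((((L : ℝ) ^ d) ^ j)⁻¹ * (∑ i ∈ Finset.range j, ε i) ^ 2 * ∑ x ∈ blk (j, y), fnorm τ (F x) ^ 2) :=
            mul_le_mul_of_nonneg_left h2 (ha j)
        _ = a j * ((((L : ℝ) ^ d) ^ j)⁻¹ * (∑ i ∈ Finset.range j, ε i) ^ 2) * ∑ x ∈ blk (j, y), fnorm τ (F x) ^ 2 := by ring
        _ ≤ κ * ∑ x ∈ blk (j, y), fnorm τ (F x) ^ 2 := mul_le_mul_of_nonneg_right (hκ j hj) hS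
    nlinarith [mul_le_mul_of_nonneg_left h1 (ha j), h3, ha j]
  -- sum over `(j, y)`; the block sums add up to at most `⟨f, f⟩` by disjointness
  set B : Finset (ℕ × Site d) := (Finset.range (m + 1)).biUnion fun j => (Λ j).image (Prod.mk j) with hB
  have hmemB : ∀ p : ℕ × Site d, p ∈ B ↔ p.1 ∈ Finset.range (m + 1) ∧ p.2 ∈ Λ p.1 := by
    intro p
    simp only [hB, Finset.mem_biUnion, Finset.mem_image]
    constructor
    · rintro ⟨j, hj, y, hy, rfl⟩
      exact ⟨hj, hy⟩
    · rintro ⟨hj, hy⟩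
      exact ⟨p.1, hj, p.2, hy, rfl⟩
  have hdisjB : (↑(Finset.range (m + 1)) : Set ℕ).PairwiseDisjoint (fun j => (Λ j).image (Prod.mk j)) := by
    intro j₁ _ j₂ _ hne
    rw [Function.onFun, Finset.disjoint_left]
    intro p hp₁ hp₂
    rw [Finset.mem_image] at hp₁ hp₂
    obtain ⟨y₁, _, rfl⟩ := hp₁
    obtain ⟨y₂, _, h2⟩ := hp₂
    exact hne (Prod.ext_iff.1 h2).1.symm
  have hlevel : ∀ G : ℕ × Site d → ℝ, ∑ j ∈ Finset.range (m + 1), ∑ y ∈ Λ j, G (j, y) = ∑ p ∈ B, G p := by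
    intro G
    rw [hB, Finset.sum_biUnion hdisjB]
    refine Finset.sum_congr rfl fun j _ => ?_
    rw [Finset.sum_image fun y _ y' _ h' => (Prod.ext_iff.1 h').2]
  have hblk : ∀ (p : ℕ × Site d) (x : Site d), x ∈ blk p ↔ blockMapIter L p.1 x = p.2 := fun p x => by
    haveI : NeZero (L ^ p.1) := ⟨pow_ne_zero p.1 (NeZero.ne L)⟩
    show x ∈ blockSites (L ^ p.1) p.2 ↔ _
    rw [mem_blockSites_iff, blockMapIter_eq_blockMap_pow]
  have hdisjblk : (↑B : Set (ℕ × Site d)).PairwiseDisjoint blk := by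
    intro p hp q hq hne
    rw [Finset.mem_coe, hmemB] at hp hq
    rw [Function.onFun, Finset.disjoint_left]
    intro x hxp hxq
    rw [hblk] at hxp hxq
    have hne' : (q.1, q.2) ≠ (p.1, p.2) := fun h' => hne (Prod.ext (Prod.ext_iff.1 h').1.symm (Prod.ext_iff.1 h').2.symm)
    exact hdisj p.1 hp.1 p.2 hp.2 q.1 hq.1 q.2 hq.2 hne' x hxp hxq
  have hcover : ∑ p ∈ B, ∑ x ∈ blk p, fnorm τ (F x) ^ 2 ≤ formE τ s f f := by
    rw [← Finset.sum_biUnion hdisjblk]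
    exact sum_fnorm_sq_le_formE τ hτp f _
  -- assemble
  calc ∑ j ∈ Finset.range (m + 1), a j * ∑ y ∈ Λ j, fnorm τ (QprimeIter (zdBlocking d L) (bgT L (1 : Site d → Fin d → 𝔸ˣ)) j F y) ^ 2
      = ∑ j ∈ Finset.range (m + 1), ∑ y ∈ Λ j, a j * fnorm τ (QprimeIter (zdBlocking d L) (bgT L (1 : Site d → Fin d → 𝔸ˣ)) j F y) ^ 2 :=
        Finset.sum_congr rfl fun j _ => Finset.mul_sum _ _ _
    _ ≤ ∑ j ∈ Finset.range (m + 1), ∑ y ∈ Λ j,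
          (2 * (a j * fnorm τ (QprimeIter (zdBlocking d L) (bgT L U₀) j F y) ^ 2) + 2 * κ * ∑ x ∈ blk (j, y), fnorm τ (F x) ^ 2) :=
        Finset.sum_le_sum fun j hj => Finset.sum_le_sum fun y hy => hpt j hj y hy
    _ = 2 * ∑ j ∈ Finset.range (m + 1), a j * ∑ y ∈ Λ j, fnorm τ (QprimeIter (zdBlocking d L) (bgT L U₀) j F y) ^ 2 +
          2 * κ * ∑ p ∈ B, ∑ x ∈ blk p, fnorm τ (F x) ^ 2 := by
        rw [← hlevel (fun p => ∑ x ∈ blk p, fnorm τ (F x) ^ 2)]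
        simp only [Finset.sum_add_distrib, Finset.mul_sum]
    _ ≤ 2 * ∑ j ∈ Finset.range (m + 1), a j * ∑ y ∈ Λ j, fnorm τ (QprimeIter (zdBlocking d L) (bgT L U₀) j F y) ^ 2 +
          2 * κ * formE τ s f f := by
        have h2κ : 0 ≤ 2 * κ := by positivity
        linarith [mul_le_mul_of_nonneg_left hcover h2κ]

end Penalty

/-! ## §5  Assembly: the flat form against the near-flat one, and the transfer of coercivity -/

section Assembly

variable [FiniteDimensional ℝ 𝔸] {L : ℕ} [NeZero L] {η : ℝ} {U₀ : Site d → Fin d → 𝔸ˣ} {θ : ℝ}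

include hτt hτs in
/-- ★★★ **THE FLAT FORM IS DOMINATED BY TWICE THE NEAR-FLAT FORM PLUS AN EXPLICIT ERROR**:
`⟨f, Ω₀Δ′_a(1)Ω₀ f⟩_τ ≤ 2⟨f, Ω₀Δ′_a(U₀)Ω₀ f⟩_τ + 2(dθ² + κ)·⟨f, f⟩_τ` for unitary `U₀` whose bond conjugations are `θη`-close to `1` in the `τ`-size, unitary averaged transporters
below `m` `ε_i`-close to `1`, weights with `a_j(Lᵈ)^{−j}(Σ_{i<j}ε_i)² ≤ κ`, disjoint level blocks.
[cite: Balaban1985BackgroundPropagators, (3.23)–(3.24) p.394, (3.86) p.407, Thm 3.11 p.416; Balaban1985Averaging, (122)–(126) p.36] -/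
theorem formE_deltaPrimeADom_one_le_near_flat (hη : 0 < η) (hU : ∀ (x : Site d) (κ' : Fin d), U₀ x κ' ∈ unitaryUnits 𝔸)
    (hR : ∀ (x : Site d) (μ : Fin d) (b : 𝔸), fnorm τ (conjR (U₀ x μ) b - b) ≤ θ * η * fnorm τ b)
    (m : ℕ) {a : ℕ → ℝ} (ha : ∀ j, 0 ≤ a j) (Λ : ℕ → Finset (Site d)) {s : Finset (Site d)}
    (hdisj : ∀ j ∈ Finset.range (m + 1), ∀ y ∈ Λ j, ∀ i ∈ Finset.range (m + 1), ∀ y' ∈ Λ i, (i, y') ≠ (j, y) →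
      ∀ x : Site d, blockMapIter L j x = y → blockMapIter L i x ≠ y')
    {ε : ℕ → ℝ} (hε : ∀ i, 0 ≤ ε i) (hT : ∀ i, i < m → ∀ z y : Site d, bgT L U₀ i z y ∈ unitaryUnits 𝔸)
    (hTε : ∀ i, i < m → ∀ (z y : Site d) (b : 𝔸), fnorm τ (conjR (bgT L U₀ i z y) b - b) ≤ ε i * fnorm τ b)
    {κ : ℝ} (hκ0 : 0 ≤ κ) (hκ : ∀ j ∈ Finset.range (m + 1), a j * ((((L : ℝ) ^ d) ^ j)⁻¹ * (∑ i ∈ Finset.range j, ε i) ^ 2) ≤ κ)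
    (f : suppSub (𝔸 := 𝔸) s) :
    formE τ s f (deltaPrimeADom L (1 : Site d → Fin d → 𝔸ˣ) η τ hτp m a Λ s f) ≤
      2 * formE τ s f (deltaPrimeADom L U₀ η τ hτp m a Λ s f) + 2 * (d * θ ^ 2 + κ) * formE τ s f f := by
  have hone : ∀ (x : Site d) (κ' : Fin d), (1 : Site d → Fin d → 𝔸ˣ) x κ' ∈ unitaryUnits 𝔸 := fun _ _ => (unitaryUnits 𝔸).one_mem
  -- both forms as gradient energy + penalty, in `|·|²_τ`
  have hsq : ∀ (V : Site d → Fin d → 𝔸ˣ) (hV : ∀ (x : Site d) (κ' : Fin d), V x κ' ∈ unitaryUnits 𝔸),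
      formE τ s f (deltaPrimeADom L V η τ hτp m a Λ s f) =
        (∑ μ : Fin d, ∑ᶠ x, fnorm τ (covDerivFwd η V μ (f : Site d → 𝔸) x) ^ 2) +
          ∑ j ∈ Finset.range (m + 1), a j * ∑ y ∈ Λ j, fnorm τ (QprimeIter (zdBlocking d L) (bgT L V) j (f : Site d → 𝔸) y) ^ 2 := by
    intro V hV
    rw [formE_deltaPrimeADom (L := L) (m := m) (a := a) (Λ := Λ) τ hτp hτt hτs hV f f]
    congr 1
    · exact Finset.sum_congr rfl fun μ _ => finsum_congr fun x => (fnorm_sq hτp _).symm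
    · exact Finset.sum_congr rfl fun j _ => by rw [Finset.sum_congr rfl fun y _ => (fnorm_sq hτp _).symm]
  rw [hsq 1 hone, hsq U₀ hU]
  have hG := gradEnergy_one_le τ hτp hτs hη hR f
  have hP := penalty_one_le τ hτp hτt hτs m ha Λ hdisj hε hT hTε hκ0 hκ f
  nlinarith [hG, hP]

include hτt hτs in
/-- ★★★ **TRANSFER OF COERCIVITY TO THE NEAR-FLAT BACKGROUND**: a flat constant (`a₀·⟨g, g⟩_τ ≤ ⟨g, Ω₀Δ′_a(1)Ω₀ g⟩_τ` for all `g` — this seat's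
`B9Thm31FlatPoincareCoerciveZd` gives `a₀ = min{8, a}`, scale-free) yields `(a₀∕2 − dθ² − κ)·⟨f, f⟩_τ ≤ ⟨f, Ω₀Δ′_a(U₀)Ω₀ f⟩_τ` — print's «G_□(1) positive ⟹ G_□(U) positive for
U = e^{iηA}, A small», with explicit constants. [cite: Balaban1985BackgroundPropagators, Thm 3.11 p.416, (3.86) p.407, Thm 3.1 p.397; Balaban1984PropagatorsII, (2.22) p.226] -/
theorem coercive_of_flat_coercive_near_flat (hη : 0 < η) (hU : ∀ (x : Site d) (κ' : Fin d), U₀ x κ' ∈ unitaryUnits 𝔸)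
    (hR : ∀ (x : Site d) (μ : Fin d) (b : 𝔸), fnorm τ (conjR (U₀ x μ) b - b) ≤ θ * η * fnorm τ b)
    (m : ℕ) {a : ℕ → ℝ} (ha : ∀ j, 0 ≤ a j) (Λ : ℕ → Finset (Site d)) {s : Finset (Site d)}
    (hdisj : ∀ j ∈ Finset.range (m + 1), ∀ y ∈ Λ j, ∀ i ∈ Finset.range (m + 1), ∀ y' ∈ Λ i, (i, y') ≠ (j, y) →
      ∀ x : Site d, blockMapIter L j x = y → blockMapIter L i x ≠ y')
    {ε : ℕ → ℝ} (hε : ∀ i, 0 ≤ ε i) (hT : ∀ i, i < m → ∀ z y : Site d, bgT L U₀ i z y ∈ unitaryUnits 𝔸)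
    (hTε : ∀ i, i < m → ∀ (z y : Site d) (b : 𝔸), fnorm τ (conjR (bgT L U₀ i z y) b - b) ≤ ε i * fnorm τ b)
    {κ : ℝ} (hκ0 : 0 ≤ κ) (hκ : ∀ j ∈ Finset.range (m + 1), a j * ((((L : ℝ) ^ d) ^ j)⁻¹ * (∑ i ∈ Finset.range j, ε i) ^ 2) ≤ κ)
    {a₀ : ℝ} (hflat : ∀ g : suppSub (𝔸 := 𝔸) s, a₀ * formE τ s g g ≤ formE τ s g (deltaPrimeADom L (1 : Site d → Fin d → 𝔸ˣ) η τ hτp m a Λ s g))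
    (f : suppSub (𝔸 := 𝔸) s) :
    (a₀ / 2 - d * θ ^ 2 - κ) * formE τ s f f ≤ formE τ s f (deltaPrimeADom L U₀ η τ hτp m a Λ s f) := by
  have h1 := hflat f
  have h2 := formE_deltaPrimeADom_one_le_near_flat τ hτp hτt hτs hη hU hR m ha Λ hdisj hε hT hTε hκ0 hκ f
  have h0 : 0 ≤ formE τ s f f := formE_self_nonneg' hτp f
  nlinarith [h1, h2, h0]

end Assembly

end Literature.MathematicalPhysics.QuantumFieldTheory.Balaban1983to89.B9Eq324NearFlatFormComparisonZd

end
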